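import Summits.QuantumFields.BalabanUV.T4Continuum.Support.AveragingDeficitCoreAxial
import Summits.QuantumFields.BalabanUV.T4Continuum.Support.AveragingDeficitDerivAssembly

/-!
# AveragingDeficitDerivWallProof (T⁴ programme, node NE3, row NE3-R2) — THE DERIVATIVE WALL β OF THE NE3 ENERGY ROUTE IS
# A THEOREM: `deficitDerivWall_holds : 1 ≤ L → DeficitDerivWall d N L C(d,L) (1/(512(d+1)(d+4)L²)) R(d,L)`, hence
# `ClaimBetaLoc d N L` and `ClaimBetaPer d N L` (GAPS G-ne3p2-1 of the cell `pub-balaban`)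

HONEST FRAMING (cell `pub-balaban`, T4-DAG PAGE 1; unit `b2b-balaban-t4-ne3r2-p1` = owner of BINDER-OWNERS row NE3-R2).
The cell's T4 target is the finite-torus continuum limit of the unit-scale averaged loop expectations — NOT infinite volume,
NO mass gap, NOT the Clay problem, NOT summit progress.  What this file proves is ONE INPUT of ONE route to ONE spine
estimate: the wall β = `T4AveragingDeficitWall.DeficitDerivWall` (typed by the retired lineage `b2b-balaban-t4-ne3-p2`,
asserted nowhere until now), for Bałaban's one-step average (42) of `U(N)` lattice gauge fields on `ℤ^d`, in the scale-free
form of the typed wall.  With the tree's `claimBetaLoc_iff_derivWall` / `claimBetaPer_iff_derivWall`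
(`T4AveragingDeficitNonAbelian` §9/§11, where the value walls β′-per / β′-loc are theorems) the two honest repairs of the
lineage's CLAIM β follow.  NE3 ITSELF IS NOT PROVED HERE: on the energy route NE3(A) ⇐ ML ∧ R0 ∧ β ∧ γ and NE3(D) ⇐ the
same ∧ δ (record `t4/T4-EST-NE3-P2.md` §0 (e)); ML (tangent coercivity), R0 (admissibility), γ (tangent lift) and the
δ dictionary remain exactly as recorded there.  NE3 stays COND-free (no BetaPertH / (B) / (B^μ)).
THE PROOF (this unit's files, all [folklore] matrix calculus and lattice bookkeeping on the tree's transcriptions of B7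
(9)/(42)/(44)/(45)/(48) and B11 (5)): `AveragingDeficitTransport/Locality/NearIdentity` (linearised transport),
`AveragingDeficitSideDeriv/PlaqDeriv` (the derivative of the average, skewness), `AveragingDeficitPlaqLin/PlaqLinBound`
((DL): `Ω_P = L^{−d}Σ_k d_Vψ(p_k) + O(a‖ψ‖₁)` in the axial gauge), `AveragingDeficitCoreAxial` ((W)+(M): flux
linearisation of the tree + covariant telescoping), THIS FILE (the gauge step (45) to the axial gauge of B7 p. 24 ⇒
`CoarseCore`), and `AveragingDeficitCounting/DerivCore/DerivAssembly` (β ⇐ CoarseCore).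
CITATION HEADER: no printed sentence is a hypothesis; the manuscripts under audit are not cited for any disputed step;
context: T. Bałaban, Commun. Math. Phys. **98** (1985) 17–51 [Balaban1985Averaging] ((42), (44), (45), p. 24), **102**
(1985) 277–309 [Balaban1985Variational] ((5)).  PLACEMENT: `Summits/QuantumFields/BalabanUV/` (human rule 2026-08-19).
Record: HOME `t4/T4-EST-NE3-R2.md`.
-/

set_option autoImplicit false

open scoped BigOperators Matrix Matrix.Norms.L2Operator Topology
open NormedSpace Finset Filter

namespace Summit.QuantumFields.BalabanUV.T4Continuum.AveragingDeficitDerivWallProof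

open Literature.MathematicalPhysics.QuantumFieldTheory.Balaban1983to89
open B7Prop1Explicit B7Prop2Explicit MatrixLog UnitaryModel
open T4AveragingDeficitWall hiding Site Plane Plaq Bond
open T4AveragingDeficitWallBoundary (stencilIdx stencilOff ClaimBetaPer ClaimBetaLoc)
open T4AveragingDeficitNonAbelian (Ad_mul Ad_sub claimBetaPer_iff_derivWall claimBetaLoc_iff_derivWall)
open AveragingDeficitTransport AveragingDeficitLocality AveragingDeficitNearIdentity AveragingDeficitCounting
open AveragingDeficitSideDeriv AveragingDeficitPlaqDeriv AveragingDeficitDerivCore AveragingDeficitPlaqLin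
open AveragingDeficitPlaqLinBound AveragingDeficitCoreAxialPrep AveragingDeficitCoreAxial AveragingDeficitDerivAssembly

noncomputable section

variable {d : ℕ} {n : Type*} [Fintype n] [DecidableEq n] [Nonempty n]

local notation "𝕄" => Matrix n n ℂ
local notation "Site" => B7Prop1Explicit.Site
local notation "Plane" => T4AveragingDeficitWall.Plane
local notation "Plaq" => T4AveragingDeficitWall.Plaq

/-! ## §1 Gauge covariance of the per-plaquette data -/

omit [Nonempty n] in
/-- `Ad_u` of a conjugate: `Ad_{u v u⁻¹… }` bookkeeping — `Ad_{a b c⁻¹}(Ad_c X) = Ad_a (Ad_b X)`. [folklore] -/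
theorem Ad_conj_cancel (a b c : 𝕄ˣ) (X : 𝕄) : Ad (a * b * c⁻¹) (Ad c X) = Ad a (Ad b X) := by
  rw [Ad_mul, Ad_mul, ← Ad_mul c⁻¹ c, inv_mul_cancel, Ad_one]

/-- The flux transforms covariantly in the ball: `F^u(p) = Ad_{u(p)} F(p)`. [cite: Balaban1985Averaging, (11) p.19] -/
theorem flux_gaugeAct {u : Site d → 𝕄ˣ} (hu : ∀ x, u x ∈ unitaryUnits 𝕄) (V : Site d → Fin d → 𝕄ˣ) (p : Plaq d)
    (hp : ‖((fhol V p : 𝕄ˣ) : 𝕄) - 1‖ < 1) : flux (gaugeAct u V) p = Ad (u p.1) (flux V p) := by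
  have hf : fhol (gaugeAct u V) p = u p.1 * fhol V p * (u p.1)⁻¹ := hol_gaugeAct_closed _ _ _ _ (disp_plaqWord _ _)
  unfold flux
  rw [hf, Units.val_mul, Units.val_mul, mlog_units_conj (mem_U1_of_unitary (hu p.1)) hp]
  rfl

/-- The covariant flux gradient transforms covariantly. [cite: Balaban1985Averaging, (11) p.19] -/
theorem covGrad_flux_gaugeAct {u : Site d → 𝕄ˣ} (hu : ∀ x, u x ∈ unitaryUnits 𝕄) (V : Site d → Fin d → 𝕄ˣ)
    (hball : ∀ p : Plaq d, ‖((fhol V p : 𝕄ˣ) : 𝕄) - 1‖ < 1) (x : Site d) (κ : Fin d) (π : Plane d) :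
    covGrad (gaugeAct u V) (flux (gaugeAct u V)) x κ π = Ad (u x) (covGrad V (flux V) x κ π) := by
  unfold covGrad
  rw [flux_gaugeAct hu V _ (hball _), flux_gaugeAct hu V _ (hball _), Ad_sub]
  show Ad (u x * V x κ * (u (x + e κ))⁻¹) (Ad (u (x + e κ)) (flux V (x + e κ, π))) - Ad (u x) (flux V (x, π)) = _
  rw [Ad_conj_cancel]

/-! ## §2 The gauge step: `CoarseCore` holds -/

set_option maxHeartbeats 800000 in
/-- **THE PER-PLAQUETTE CORE ESTIMATE HOLDS** with `c₁ = coreC₁ d L`, `c₂ = coreC₂ d L`,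
`a₀ = 1/(512(d+1)(d+4)L²)`, `R_b = coreRad d L`: pass to the axial gauge of B7 p. 24 at the far corner (the derivative
`t`, the stencil pairing, the curl / flux-gradient / direction norms are gauge invariant) and apply `core_axial`.
[cite: Balaban1985Averaging, (45) p.24, pp.24–25] -/
theorem coarseCore_holds (L : ℕ) (hL : 1 ≤ L) :
    CoarseCore d n L (coreC₁ d L) (coreC₂ d L) (1 / (512 * (d + 1) * (d + 4) * (L : ℝ) ^ 2)) (coreRad d L) := by
  letI : CStarAlgebra 𝕄 := {}
  intro V hV a ha haa₀ hVa ψ hψ y π t ht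
  have hL0 : (0 : ℝ) < L := by exact_mod_cast hL
  have hK : (0 : ℝ) < 512 * (d + 1) * (d + 4) * (L : ℝ) ^ 2 := by positivity
  have hsmall : 512 * (d + 1) * (d + 4) * (L : ℝ) ^ 2 * a ≤ 1 := by
    calc 512 * (d + 1) * (d + 4) * (L : ℝ) ^ 2 * a
        ≤ 512 * (d + 1) * (d + 4) * (L : ℝ) ^ 2 * (1 / (512 * (d + 1) * (d + 4) * (L : ℝ) ^ 2)) :=
          mul_le_mul_of_nonneg_left haa₀ hK.le
      _ = 1 := mul_one_div_cancel hK.ne'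
  set μ : Fin d := π.1.1
  set ν : Fin d := π.1.2
  have hμν : μ ≠ ν := ne_of_lt π.2
  set z : Site d := (L : ℤ) • y with hz
  set yc : Site d := z + (L : ℤ) • e μ + (L : ℤ) • e ν with hyc
  set u : Site d → 𝕄ˣ := axialFn V yc with hu
  set V₀ : Site d → Fin d → 𝕄ˣ := gaugeAct u V with hV₀
  set ψ₀ : Site d → Fin d → 𝕄 := dirGauge u ψ with hψ₀
  have hU : ∀ x κ, V x κ ∈ U1 𝕄 := fun x κ => mem_U1_of_unitary (hV x κ)
  have huu : ∀ x, u x ∈ unitaryUnits 𝕄 := fun x => hol_mem_of hV _ _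
  have huU : ∀ x, u x ∈ U1 𝕄 := fun x => mem_U1_of_unitary (huu x)
  -- the gauged data are admissible
  have hV₀u : IsUnitaryCfg V₀ := fun x κ => mul_mem (mul_mem (huu x) (hV x κ)) (inv_mem (huu _))
  have hV₀a : SmallField V₀ a := fun x κ κ' hκ => by
    rw [hV₀, hol_gaugeAct_closed _ _ _ _ (disp_plaqWord κ κ'), Units.val_mul, Units.val_mul]
    exact (norm_units_conj_sub_one_le (huU x) _).trans (hVa x κ κ' hκ)
  have hψ₀s : IsSkewDir ψ₀ := dirGauge_skew huu hψ
  have hbond : ∀ (x : Site d) (κ : Fin d), ‖((V₀ x κ : 𝕄ˣ) : 𝕄) - 1‖ ≤ l1 (x - yc) * a := fun x κ =>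
    axial_bond_bound V hU yc hVa ha x κ
  -- the derivative is gauge invariant
  have hball : ∀ (q : Site d) (κ : Fin d) (r : Fin d → Fin L), ‖((Wcx L V q κ (boxVec L r) : 𝕄ˣ) : 𝕄) - 1‖ < 1 :=
    norm_Wcx_sub_one_lt_one_of_smallField L hL hV ha hsmall hVa
  have hq : ∀ (q : Site d) (κ : Fin d), ∀ᶠ s in 𝓝 (0 : ℝ), ∀ r : Fin d → Fin L,
      ‖((Wcx L (vary V ψ s) q κ (boxVec L r) : 𝕄ˣ) : 𝕄) - 1‖ < 1 := fun q κ =>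
    Filter.eventually_all.mpr fun r => eventually_norm_Wcx_vary_sub_one_lt L V ψ q κ (boxVec L r) (hball q κ r)
  have ht₀ : HasDerivAt (fun s : ℝ => wt (chol L (vary V₀ ψ₀ s) (y, π))) t 0 := by
    refine ht.congr_of_eventuallyEq ?_
    refine ((hq z μ).and ((hq (z + (L : ℤ) • e μ) ν).and ((hq (z + (L : ℤ) • e ν) μ).and (hq z ν)))).mono
      fun s hs => ?_
    obtain ⟨h0, h1, h2, h3⟩ := hs
    have hcov : ∀ (q : Site d) (κ : Fin d), (∀ r : Fin d → Fin L,
        ‖((Wcx L (vary V ψ s) q κ (boxVec L r) : 𝕄ˣ) : 𝕄) - 1‖ < 1) →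
        bavg L (vary V₀ ψ₀ s) q κ = u q * bavg L (vary V ψ s) q κ * (u (q + (L : ℤ) • e κ))⁻¹ := by
      intro q κ hW
      rw [hV₀, hψ₀, ← gaugeAct_vary]
      exact bavg_gaugeAct L huU _ q κ hW
    have hconj : cplaq L (bavg L (vary V₀ ψ₀ s)) z μ ν = u z * cplaq L (bavg L (vary V ψ s)) z μ ν * (u z)⁻¹ :=
      cplaq_conj L u (bavg L (vary V ψ s)) (bavg L (vary V₀ ψ₀ s)) z μ ν (hcov z μ h0) (hcov _ ν h1) (hcov _ μ h2)
        (hcov z ν h3)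
    show wt (cplaq L (bavg L (vary V₀ ψ₀ s)) z μ ν) = wt (cplaq L (bavg L (vary V ψ s)) z μ ν)
    rw [hconj, T4AveragingDeficitWall.wt, T4AveragingDeficitWall.wt, Units.val_mul, Units.val_mul,
      nReTr_conj (Units.inv_mul (u z))]
  -- the axial core estimate for the gauged data
  have key := core_axial L hL hV₀u ha hsmall hV₀a hψ₀s y π hbond ht₀
  -- gauge invariance of the four functionals
  have hfball : ∀ p : Plaq d, ‖((fhol V p : 𝕄ˣ) : 𝕄) - 1‖ < 1 := fun p =>
    (hVa p.1 p.2.1.1 p.2.1.2 (ne_of_lt p.2.2)).trans_lt (by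
      have := T4AveragingDeficitNonAbelian.small_a_le hL (Nat.succ_le_of_lt μ.pos) ha hsmall; linarith)
  have hcurl : ∀ p : Plaq d, ‖curl V₀ ψ₀ p‖ = ‖curl V ψ p‖ := fun p => by
    rw [hV₀, hψ₀, curl_gaugeAct, norm_Ad_of_unitary (huu _)]
  have hpair : ∀ p : Plaq d, nReTr (curl V₀ ψ₀ p * flux V₀ p) = nReTr (curl V ψ p * flux V p) := fun p => by
    rw [hV₀, hψ₀, curl_gaugeAct, flux_gaugeAct huu V p (hfball p), Ad_mul_Ad, nReTr_Ad]
  have hgrad : ∀ (x : Site d) (κ : Fin d) (π' : Plane d),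
      ‖covGrad V₀ (flux V₀) x κ π'‖ = ‖covGrad V (flux V) x κ π'‖ := fun x κ π' => by
    rw [hV₀, covGrad_flux_gaugeAct huu V hfball, norm_Ad_of_unitary (huu _)]
  have hdir : ∀ (x : Site d) (κ : Fin d), ‖ψ₀ x κ‖ = ‖ψ x κ‖ := fun x κ => norm_dirGauge huu ψ x κ
  have e1 : stencilPair L V₀ ψ₀ y π = stencilPair L V ψ y π := Finset.sum_congr rfl fun k _ => hpair _
  have e2 : stencilCurlL1 L V₀ ψ₀ y π = stencilCurlL1 L V ψ y π := Finset.sum_congr rfl fun k _ => hcurl _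
  have e3 : boxGradL1 L V₀ (coreRad d L) y π = boxGradL1 L V (coreRad d L) y π :=
    Finset.sum_congr rfl fun x _ => Finset.sum_congr rfl fun κ _ => hgrad x κ π
  have e4 : dirL1 ψ₀ (box (coreRad d L) ((L : ℤ) • y)) = dirL1 ψ (box (coreRad d L) ((L : ℤ) • y)) :=
    Finset.sum_congr rfl fun x _ => Finset.sum_congr rfl fun κ _ => hdir x κ
  rw [e1, e2, e3, e4] at key
  exact key

/-! ## §3 β and the two repairs of CLAIM β -/

omit [Fintype n] [DecidableEq n] [Nonempty n] in
/-- `1 ≤ 512(d+1)(d+4)L²` for `L ≥ 1`. [folklore] -/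
theorem one_le_smallConst (L : ℕ) (hL : 1 ≤ L) : (1 : ℝ) ≤ 512 * (d + 1) * (d + 4) * (L : ℝ) ^ 2 := by
  have hL1 : (1 : ℝ) ≤ (L : ℝ) ^ 2 := one_le_pow₀ (by exact_mod_cast hL)
  have hd : (0 : ℝ) ≤ d := Nat.cast_nonneg d
  have h1 : (4 : ℝ) ≤ ((d : ℝ) + 1) * ((d : ℝ) + 4) := by nlinarith
  have h2 := mul_le_mul h1 hL1 (by norm_num) (by positivity)
  nlinarith

/-- The constant of β. [folklore] -/
def wallConst (d L : ℕ) : ℝ := assemblyConst d L (coreC₁ d L) (coreC₂ d L) (coreRad d L)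

/-- **β — THE DERIVATIVE WALL OF THE NE3 ENERGY ROUTE — IS A THEOREM** (GAPS G-ne3p2-1): for every `L ≥ 1`, `d`, `N ≥ 1`,
`DeficitDerivWall d N L (wallConst d L) (1/(512(d+1)(d+4)L²)) (wallRad d L (coreRad d L))`.  [folklore] -/
theorem deficitDerivWall_holds (L : ℕ) (hL : 1 ≤ L) :
    DeficitDerivWall d n L (wallConst d L) (1 / (512 * (d + 1) * (d + 4) * (L : ℝ) ^ 2)) (wallRad d L (coreRad d L)) := by
  have hK : (0 : ℝ) < 512 * (d + 1) * (d + 4) * (L : ℝ) ^ 2 := by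
    have hL0 : (0 : ℝ) < L := by exact_mod_cast hL
    positivity
  exact deficitDerivWall_of_coarseCore L hL (coreC_nonneg d L).1 (coreC_nonneg d L).2
    (le_of_eq (mul_one_div_cancel hK.ne')) (coarseCore_holds L hL)

/-- `wallConst ≥ 0`. [folklore] -/
theorem wallConst_nonneg (d L : ℕ) : 0 ≤ wallConst d L := by
  unfold wallConst assemblyConst
  have h1 := (coreC_nonneg d L).1; have h2 := (coreC_nonneg d L).2
  positivity

/-- **`ClaimBetaLoc d N L`** (the local repair of CLAIM β: β ∧ β′-loc) holds for `L ≥ 1`. [folklore] -/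
theorem claimBetaLoc_holds (L : ℕ) (hL : 1 ≤ L) : ClaimBetaLoc d n L := by
  have hK : (0 : ℝ) < 512 * (d + 1) * (d + 4) * (L : ℝ) ^ 2 := by
    have hL0 : (0 : ℝ) < L := by exact_mod_cast hL
    positivity
  refine (claimBetaLoc_iff_derivWall L hL).mpr ⟨wallConst d L, _, wallRad d L (coreRad d L), wallConst_nonneg d L,
    one_div_pos.mpr hK, ?_, deficitDerivWall_holds L hL⟩
  rw [div_le_one hK]
  exact one_le_smallConst L hL

/-- **`ClaimBetaPer d N L`** (the periodic repair of CLAIM β: β ∧ β′-per) holds for `L ≥ 1`. [folklore] -/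
theorem claimBetaPer_holds (L : ℕ) (hL : 1 ≤ L) : ClaimBetaPer d n L := by
  have hK : (0 : ℝ) < 512 * (d + 1) * (d + 4) * (L : ℝ) ^ 2 := by
    have hL0 : (0 : ℝ) < L := by exact_mod_cast hL
    positivity
  refine (claimBetaPer_iff_derivWall L hL).mpr ⟨wallConst d L, _, wallRad d L (coreRad d L), wallConst_nonneg d L,
    one_div_pos.mpr hK, ?_, deficitDerivWall_holds L hL⟩
  rw [div_le_one hK]
  exact one_le_smallConst L hL

end

end Summit.QuantumFields.BalabanUV.T4Continuum.AveragingDeficitDerivWallProof
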